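import Literature.NumberTheory.Rogawski1990.KottwitzSignDiagonalModel
import Literature.NumberTheory.Rogawski1990.SingularSemisimpleFrame
import Literature.NumberTheory.Rogawski1990.SingularStableClassTransfers
import Literature.NumberTheory.Rogawski1990.SingularClassOccursInAnisotropic
import Literature.NumberTheory.Rogawski1990.AdelicStableClassesInvariance
import HarnessLib

/-!
# Split-singular unitary elements are not regular; scalars in the quasi-split group; the weighted R-INV
(Rogawski, *Automorphic Representations of Unitary Groups in Three Variables* (1990), §3.1 p. 19, §3.8 Prop. 3.8.1 (a) p. 27, §5.4 (5.4.3) pp. 72–73)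

Topic `NumberTheory/Rogawski1990`; namespace `Literature.NumberTheory.Rogawski1990`; **THEOREMS ONLY** (no definition, no named fact, no instance, no
notation, no `sorry`).  Cell `pub/hodgecm-mathlib`, ENGINE T1 (crux H413 = `stmt-HodgeConjecture-24833`), row O7 «singular semisimple classes»: the
kit-independent lemmas the ED 1.24 anchor of the `SJ_G` TRICHOTOMY (O7 OWNER WORD #31 (F-3)) reads — kept OUT of the engine workfile (180 000 B cap).
HC_CM is proved only modulo the printed citations until rung 0 closes; this file consumes none of them.

* `exists_rational_antidiagThree_coe_eq_smul_one` — a norm-one scalar `ζ•1` is an element of `U(Φ₃)(L⁺)` (A-p16 (g21)'s lemma, adapted);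
* **`not_isRegularElt_of_mul_sub_eq_zero`** — `(γ − a)(γ − b) = 0`, `a ≠ b`, `γ` not scalar ⇒ `γ` is NOT regular (`charpoly γ = (X − a′)²(X − b′)` by the frame
  ★ `exists_singular_frame` + ★ `charpoly_eq_of_mul_eq_mul_diagonal`);
* `not_isRegularElt_of_coe_eq_smul_one` — a scalar is not regular; `coe_eq_smul_one_of_isStablyConj_smul_one` — stably conjugate to a scalar ⇒ equal to it;
  `isStablyConj_out_of_eq` — the chosen representative of `𝒪_st(γ₀)` is stably conjugate to `γ₀`;
* **`adelicKappaOrbitalIntegralG_eq_of_isStablyConj`** — the WEIGHTED R-INV: ★ `adelicKappaOrbitalIntegralG L H γ₀ w m f` depends only on the stable class of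
  `γ₀` (★ `MatchingAdeleG.classes_eq_of_isStablyConj`), so the signed `SJ_G` socket may be read at any representative.

## References
* [Rogawski1990] J. D. Rogawski, *Automorphic Representations of Unitary Groups in Three Variables*, Ann. of Math. Stud. 123 (1990), §3.1, §3.8, §5.4.
-/

set_option autoImplicit false

noncomputable section

open NumberField IsDedekindDomain Polynomial
open scoped Matrix MatrixGroups

namespace Literature.NumberTheory.Rogawski1990

open Literature.NumberTheory.Automorphic
open Literature.AlgebraicGeometry.ShimuraVarieties (unitaryGroup)

section SplitSingularRegularity

variable {L : Type} [Field L] [NumberField L] [IsCMField L]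




/-- `(X − a)² ∣ p ⇒ p` is not separable (plumbing). [folklore] -/
private theorem not_separable_of_X_sub_C_sq_dvd {K : Type*} [Field K] {p : Polynomial K} {a : K} (h : (Polynomial.X - Polynomial.C a) ^ 2 ∣ p) :
    ¬ p.Separable := fun hs =>
  Polynomial.not_isUnit_X_sub_C a (hs.squarefree _ (by simpa [sq] using h))

/-- **A unitary scalar lies in the quasi-split group** (A-p16 (g21) v5 §C1, adapted): for `σ(ζ)ζ = 1` the scalar `ζ•1` is an element of `U(Φ₃)(L⁺)`.
[cite: Rogawski1990, §3.8 p. 27] -/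
theorem exists_rational_antidiagThree_coe_eq_smul_one {ζ : L} (hζ : cmConjRingHom L ζ * ζ = 1) :
    ∃ γ : (UnitaryGroup.cmDatum L 3 (Matrix.of fun i j : Fin 3 => if i.val + j.val + 1 = 3 then (1 : L) else 0)).Rational, ((γ.val : GL (Fin 3) L) : Matrix (Fin 3) (Fin 3) L) = ζ • (1 : Matrix (Fin 3) (Fin 3) L) := by
  have hζ0 : ζ ≠ 0 := fun h => by rw [h, mul_zero] at hζ; exact zero_ne_one hζ
  have hunit : IsUnit (ζ • (1 : Matrix (Fin 3) (Fin 3) L)) := by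
    rw [Matrix.isUnit_iff_isUnit_det, Matrix.det_smul, Matrix.det_one, mul_one]
    exact (IsUnit.mk0 ζ hζ0).pow _
  refine ⟨⟨hunit.unit, ?_⟩, hunit.unit_spec⟩
  rw [Literature.AlgebraicGeometry.ShimuraVarieties.mem_unitaryGroup_iff, hunit.unit_spec, Matrix.smul_one_eq_diagonal,
    Matrix.diagonal_map (map_zero _), Matrix.diagonal_transpose, ← Matrix.smul_one_eq_diagonal, ← Matrix.smul_one_eq_diagonal, Matrix.smul_mul,
    Matrix.one_mul, Matrix.mul_smul, Matrix.mul_one, smul_smul]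
  rw [mul_comm, hζ, one_smul]

/-- **A split-singular non-central unitary element is NOT regular**: `(γ − a)(γ − b) = 0`, `a ≠ b`, `γ ∉ {a•1, b•1}` ⇒ `charpoly γ = (X − a′)²(X − b′)`
(★ `exists_singular_frame` + ★ `charpoly_eq_of_mul_eq_mul_diagonal`) is not separable. [cite: Rogawski1990, §3.8 Prop. 3.8.1 (a) p. 27] -/
theorem not_isRegularElt_of_mul_sub_eq_zero {H : Matrix (Fin 3) (Fin 3) L} (hH : (H.map (cmConjRingHom L)).transpose = H) (hdet : H.det ≠ 0)
    (γ : (UnitaryGroup.cmDatum L 3 H).Rational) {a b : L} (hab : a ≠ b)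
    (hγ : (((γ.val : GL (Fin 3) L) : Matrix (Fin 3) (Fin 3) L) - a • (1 : Matrix (Fin 3) (Fin 3) L)) *
      (((γ.val : GL (Fin 3) L) : Matrix (Fin 3) (Fin 3) L) - b • (1 : Matrix (Fin 3) (Fin 3) L)) = 0)
    (hnc : ¬ ∃ ζ : L, ((γ.val : GL (Fin 3) L) : Matrix (Fin 3) (Fin 3) L) = ζ • (1 : Matrix (Fin 3) (Fin 3) L)) :
    ¬ IsRegularElt (γ.val : GL (Fin 3) L) := by
  have hσ : ∀ x : L, cmConjRingHom L (cmConjRingHom L x) = x := fun x => IsCMField.complexConj_apply_apply L x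
  obtain ⟨a', b', P, Ha, Hb, -, -, -, -, hγP, -⟩ := exists_singular_frame (cmConjRingHom L) hσ H hH hdet γ hab hγ
    (fun h => hnc ⟨a, h⟩) (fun h => hnc ⟨b, h⟩)
  rw [finSum_smul_one_eq_diagonal] at hγP
  have hchar := charpoly_eq_of_mul_eq_mul_diagonal P hγP
  unfold IsRegularElt
  rw [hchar]
  exact not_separable_of_X_sub_C_sq_dvd (a := a') ⟨Polynomial.X - Polynomial.C b', by ring⟩

/-- A SCALAR unitary element is not regular (`charpoly (ζ•1) = (X − ζ)³`). [cite: Rogawski1990, §3.8 p. 27] -/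
theorem not_isRegularElt_of_coe_eq_smul_one {H : Matrix (Fin 3) (Fin 3) L} (γ : (UnitaryGroup.cmDatum L 3 H).Rational) {ζ : L}
    (hζ : ((γ.val : GL (Fin 3) L) : Matrix (Fin 3) (Fin 3) L) = ζ • (1 : Matrix (Fin 3) (Fin 3) L)) :
    ¬ IsRegularElt (γ.val : GL (Fin 3) L) := by
  unfold IsRegularElt
  rw [hζ, Matrix.smul_one_eq_diagonal, Matrix.charpoly_diagonal, Finset.prod_const, Finset.card_univ, Fintype.card_fin]
  exact not_separable_of_X_sub_C_sq_dvd (a := ζ) ⟨Polynomial.X - Polynomial.C ζ, by ring⟩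

/-- An element stably conjugate to a scalar IS that scalar. [cite: Rogawski1990, §3.1 p. 19] -/
theorem coe_eq_smul_one_of_isStablyConj_smul_one {H : Matrix (Fin 3) (Fin 3) L} {γ δ : (UnitaryGroup.cmDatum L 3 H).Rational} {ζ : L}
    (h : IsStablyConj (cmConjRingHom L) H γ δ)
    (hδ : ((δ.val : GL (Fin 3) L) : Matrix (Fin 3) (Fin 3) L) = ζ • (1 : Matrix (Fin 3) (Fin 3) L)) :
    ((γ.val : GL (Fin 3) L) : Matrix (Fin 3) (Fin 3) L) = ζ • (1 : Matrix (Fin 3) (Fin 3) L) := by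
  obtain ⟨g, hg⟩ := isStablyConj_iff.1 h
  have hg' : (γ.val : GL (Fin 3) L) = g⁻¹ * (δ.val : GL (Fin 3) L) * g := by
    rw [← hg]; group
  have := congrArg (fun u : GL (Fin 3) L => (u : Matrix (Fin 3) (Fin 3) L)) hg'
  simp only [Units.val_mul] at this
  rw [this, hδ, Matrix.mul_smul, Matrix.mul_one, Matrix.smul_mul, ← Units.val_mul, inv_mul_cancel, Units.val_one]

/-- Stable conjugacy of the chosen representative. [cite: Rogawski1990, §3.1 p. 19] -/
theorem isStablyConj_out_of_eq {H : Matrix (Fin 3) (Fin 3) L} {𝒪 : StableClass (cmConjRingHom L) H} {γ₀ : (UnitaryGroup.cmDatum L 3 H).Rational}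
    (he : 𝒪 = stableClassOf (cmConjRingHom L) H γ₀) :
    IsStablyConj (cmConjRingHom L) H
      (Quotient.out (s := stableConjSetoid _ _) 𝒪) γ₀ :=
  stableClassOf_eq_iff.mp
    ((Quotient.out_eq (s := stableConjSetoid _ _) 𝒪).trans he)


/-- **Weighted R-INV**: the κ-weighted adelic sum over the quasi-split carrier is a function of the stable class of `γ₀` (★ `MatchingAdeleG.classes_eq_of_isStablyConj`).
[cite: Rogawski1990, §5.4 (5.4.3) pp. 72–73] -/
theorem adelicKappaOrbitalIntegralG_eq_of_isStablyConj {H : Matrix (Fin 3) (Fin 3) L} {γ₀ γ₀' : (UnitaryGroup.cmDatum L 3 H).Rational}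
    (h : IsStablyConj (cmConjRingHom L) H γ₀ γ₀')
    [∀ g : (UnitaryGroup.cmDatum L 3 (Matrix.of fun i j : Fin 3 => if i.val + j.val + 1 = 3 then (1 : L) else 0)).Adelic,
      MeasurableSpace ((UnitaryGroup.cmDatum L 3 (Matrix.of fun i j : Fin 3 => if i.val + j.val + 1 = 3 then (1 : L) else 0)).Adelic ⧸ Subgroup.centralizer ({g} : Set (UnitaryGroup.cmDatum L 3 (Matrix.of fun i j : Fin 3 => if i.val + j.val + 1 = 3 then (1 : L) else 0)).Adelic))]
    (wt : ConjClasses (UnitaryGroup.cmDatum L 3 (Matrix.of fun i j : Fin 3 => if i.val + j.val + 1 = 3 then (1 : L) else 0)).Adelic → ℂ)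
    (m : OrbitalMeasureFamily (UnitaryGroup.cmDatum L 3 (Matrix.of fun i j : Fin 3 => if i.val + j.val + 1 = 3 then (1 : L) else 0)).Adelic) (f : (UnitaryGroup.cmDatum L 3 (Matrix.of fun i j : Fin 3 => if i.val + j.val + 1 = 3 then (1 : L) else 0)).Adelic → ℂ) :
    adelicKappaOrbitalIntegralG L H γ₀ wt m f =
      adelicKappaOrbitalIntegralG L H γ₀' wt m f := by
  unfold adelicKappaOrbitalIntegralG
  rw [MatchingAdeleG.classes_eq_of_isStablyConj L H h]


end SplitSingularRegularity

end Literature.NumberTheory.Rogawski1990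

end
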